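import Literature.NumberTheory.Automorphic.AutomorphicTwistBJ
import Literature.NumberTheory.Automorphic.GL2AdelicWeightVectors
import Literature.NumberTheory.Automorphic.StrongArtinGL2WeightOneDictionary
import Literature.NumberTheory.Automorphic.AutomorphicRepSubquotientTransfer
import HarnessLib

/-!
# Twisting by a finite-order character preserves the archimedean parameter and weight one

Topic `NumberTheory/Automorphic`; theorems and two definitions (`twistWEquiv`, `twistQuotEquiv`),
everything proved, no named fact. Companion of `AutomorphicTwistBJ` (the twist `π ⊗ (χ ∘ det)` of a
Borel–Jacquet datum `π = W / W'` by a Hecke character `χ` of finite order) used by the weight-one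
dictionary of `StrongArtinGL2WeightOneDescent`:

* `AutomorphicRepData.twistWEquiv`, `twistQuotEquiv` — the twisting isomorphisms `W ≃ W · (χ∘det)`
  and `W / W' ≃ (W · (χ∘det)) / (W' · (χ∘det))`;
* `AutomorphicRepData.hasLieAction_twist` — the Lie algebra action of `π ⊗ (χ ∘ det)` is the
  conjugate of that of `π` (`X ((χ∘det) φ) = (χ∘det) X φ`, `lieDeriv_mulChar`, as `χ ∘ det` is trivial
  on `exp 𝔤` for `χ` of finite order, `detTwist_ofArch_expMem`);
* `AutomorphicRepData.HasArchParameter.twist` — **the archimedean (Harish-Chandra) parameter of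
  `π ⊗ (χ ∘ det)` is that of `π`** (`GL_n` over any number field; conjugation invariance
  `HasArchParameter.conjBy` of `AutomorphicRepSubquotientTransfer`);
* `AutomorphicRepData.detTwist_ofArch_neg_one` — `χ(det(-1_∞)) = 1` on `GL₂(𝔸_ℚ)`
  (`-1_∞ = ι_𝔸(k_π) = exp(π W)`, `Rat.iotaA_rotK_pi`, `rotK_eq_expMem`);
* `AutomorphicRepData.IsOfWeightOne.twist` — **twists of weight-one representations of `GL₂(𝔸_ℚ)`
  are of weight one** (`IsOfWeightOne` of `StrongArtinGL2WeightOneDictionary`: parameter `{0,0}` and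
  `r(-1_∞) ≡ -1`);
* `AutomorphicRepData.twist_W'_eq_bot` — clean data have clean twists.

Borel–Jacquet 1979, §4.6 (the `(𝔤, K_∞) × G(𝔸_f)`-module structure); Jacquet–Langlands 1970, §11
(`π ⊗ χ`); Gelbart 1997, Remark 2.5.2 (weight one: `π_∞ = π(1, sgn)`).

## References

* A. Borel, H. Jacquet, *Automorphic forms and automorphic representations*, Proc. Sympos. Pure
  Math. 33 (1979), part 1, §4.6 [BorelJacquet1979].
* H. Jacquet, R. P. Langlands, *Automorphic Forms on GL(2)*, LNM 114 (1970), §11 [JacquetLanglands1970].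
* S. Gelbart, *Three lectures on the modularity of `ρ̄_{E,3}` …* (1997), Remark 2.5.2 [Gelbart1997].
* L. Clozel, *Motifs et formes automorphes* (1990), §3.3 [Clozel1990].
-/

noncomputable section

open scoped MatrixGroups Matrix Classical
open NumberField IsDedekindDomain

namespace Literature.NumberTheory.Automorphic

-- Mathlib idiom (Mathlib/Algebra/Lie/OfAssociative.lean); commutator brackets on `End V` and matrices
attribute [local instance 100] LieRing.ofAssociativeRing

namespace AutomorphicRepData

/-! ### The twist on `W` and on `W / W'`; the Lie algebra action and the archimedean parameter -/

section General

variable {n : ℕ} {K : Type} [Field K] [NumberField K] {hcpt : isCompact_glFiniteIntegralLevel n K}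
  (π : AutomorphicRepData (AutomorphyDatum.gl n K hcpt)) (χ : GaloisRepresentations.HeckeCharacter K)
  (hχ : χ.IsFiniteOrder)

/-- A clean datum (`W' = ⊥`) has a clean twist. [folklore] -/
theorem twist_W'_eq_bot (hbot : π.W' = ⊥) : (π.twist χ hχ).W' = ⊥ := by
  rw [twist_W', hbot, Submodule.map_bot]

/-- **`φ ↦ (χ ∘ det) · φ : W ≃ W · (χ ∘ det)`**, the twisting isomorphism on the big space. [folklore] -/
def twistWEquiv : π.W ≃ₗ[ℂ] (π.twist χ hχ).W :=
  LinearEquiv.ofBijective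
    ((mulChar (detTwist n χ)).restrict (p := π.W) (q := (π.twist χ hχ).W) fun _ hφ => Submodule.mem_map_of_mem hφ)
    ⟨fun _ _ h => Subtype.ext (mulChar_injective _ (congrArg Subtype.val h)), fun ψ => by
      obtain ⟨φ, hφ, hφψ⟩ := Submodule.mem_map.1 ψ.2
      exact ⟨⟨φ, hφ⟩, Subtype.ext hφψ⟩⟩

/-- Unfolding `twistWEquiv`. [folklore] -/
@[simp] theorem coe_twistWEquiv (φ : π.W) :
    ((π.twistWEquiv χ hχ φ : (π.twist χ hχ).W) : (AdelicGroupData.gl n K).Adelic → ℂ) = mulChar (detTwist n χ) φ := rfl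

/-- The twisting isomorphism maps `W'` (inside `W`) onto `W' · (χ ∘ det)` (inside `W · (χ ∘ det)`). [folklore] -/
theorem map_twistWEquiv_kerQuot :
    π.kerQuot.map (π.twistWEquiv χ hχ : π.W →ₗ[ℂ] (π.twist χ hχ).W) = (π.twist χ hχ).kerQuot := by
  ext ψ
  simp only [kerQuot, Submodule.mem_map, Submodule.mem_comap, Submodule.subtype_apply, twist_W']
  constructor
  · rintro ⟨φ, hφ, rfl⟩
    exact ⟨φ, hφ, rfl⟩
  · rintro ⟨φ', hφ', hψ⟩
    exact ⟨⟨φ', π.lt.le hφ'⟩, hφ', Subtype.ext hψ⟩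

/-- **`W / W' ≃ (W ⊗ χ) / (W' ⊗ χ)`** induced by the twisting isomorphism. [folklore] -/
def twistQuotEquiv : π.Quot ≃ₗ[ℂ] (π.twist χ hχ).Quot :=
  Submodule.Quotient.equiv π.kerQuot (π.twist χ hχ).kerQuot (π.twistWEquiv χ hχ) (π.map_twistWEquiv_kerQuot χ hχ)

/-- `twistQuotEquiv [φ] = [(χ ∘ det) · φ]`. [folklore] -/
theorem twistQuotEquiv_mkQ (φ : π.W) :
    π.twistQuotEquiv χ hχ (π.mkQ φ) = (π.twist χ hχ).mkQ (π.twistWEquiv χ hχ φ) := rfl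

/-- **The Lie algebra action of the twist** is the conjugate of that of `π` by the twisting isomorphism:
`X ((χ ∘ det) · φ) = (χ ∘ det) · X φ` since `χ ∘ det` is trivial on `exp 𝔤` (`χ` of finite order).
[cite: BorelJacquet1979, §4.6] -/
theorem hasLieAction_twist {ρ𝔤 : (AutomorphyDatum.gl n K hcpt).arch.lie →ₗ⁅ℝ⁆ Module.End ℂ π.Quot}
    (hρ : π.HasLieAction ρ𝔤) : (π.twist χ hχ).HasLieAction (LieHom.conjBy ρ𝔤 (π.twistQuotEquiv χ hχ)) := by
  intro X ψ
  obtain ⟨φ, rfl⟩ : ∃ φ, π.twistWEquiv χ hχ φ = ψ := (π.twistWEquiv χ hχ).surjective ψ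
  rw [LieHom.conjBy_apply, ← twistQuotEquiv_mkQ, LinearEquiv.symm_apply_apply, hρ X φ, twistQuotEquiv_mkQ]
  congr 1
  refine Subtype.ext ?_
  change mulChar (detTwist n χ) (lieDeriv (AutomorphyDatum.gl n K hcpt).ofArch X (φ : (AdelicGroupData.gl n K).Adelic → ℂ)) =
    lieDeriv (AutomorphyDatum.gl n K hcpt).ofArch X (mulChar (detTwist n χ) (φ : (AdelicGroupData.gl n K).Adelic → ℂ))
  rw [lieDeriv_mulChar _ (detTwist_ofArch_expMem hχ)]

/-- **Twisting by a finite-order character preserves the archimedean parameter** (the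
infinitesimal character of `π_∞ ⊗ (χ_∞ ∘ det)` is that of `π_∞`, `χ_∞ ∘ det` being trivial on the
identity component). [cite: BorelJacquet1979, §4.6] [cite: Clozel1990, §3.3] -/
theorem HasArchParameter.twist {P : (K →+* ℂ) → Multiset ℂ} (h : π.HasArchParameter P) :
    (π.twist χ hχ).HasArchParameter P := by
  obtain ⟨ρ𝔤, hL, hP⟩ := h
  refine ⟨LieHom.conjBy ρ𝔤 (π.twistQuotEquiv χ hχ), π.hasLieAction_twist χ hχ hL, ?_⟩
  rw [LieHom.conjBy_comp]
  exact hP.conjBy _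

end General

/-! ### Weight one -/

section WeightOne

open GL2Real

variable {hcpt : isCompact_glFiniteIntegralLevel 2 ℚ}

/-- **`χ ∘ det` is trivial on the archimedean `-1`** of the `GL₂/ℚ` datum, for `χ` of finite order:
`-1_∞ = ι_𝔸(k_π) = exp(π W)` lies on a one-parameter subgroup. [folklore] -/
theorem detTwist_ofArch_neg_one {χ : GaloisRepresentations.HeckeCharacter ℚ} (hχ : χ.IsFiniteOrder) :
    detTwist 2 χ ((AutomorphyDatum.gl 2 ℚ hcpt).ofArch ⟨-1, trivial⟩) = 1 := by
  have h := Rat.mul_ofArch_expMem_lieOfReal (hcpt := hcpt) 1 rotGen Real.pi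
  rw [one_mul, one_mul, ← rotK_eq_expMem, Rat.iotaA_rotK_pi (hcpt := hcpt)] at h
  rw [← h]
  exact detTwist_ofArch_expMem hχ _

/-- **Twists of weight-one representations are of weight one**: the parameter `{0, 0}` is
preserved (`HasArchParameter.twist`) and `r(-1_∞) ((χ∘det) φ) = (χ∘det) r(-1_∞) φ`
(`χ(det(-1_∞)) = 1`). [cite: Gelbart1997, Remark 2.5.2] [cite: BorelJacquet1979, §4.6] -/
theorem IsOfWeightOne.twist {π : AutomorphicRepData (AutomorphyDatum.gl 2 ℚ hcpt)} (h : π.IsOfWeightOne)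
    (χ : GaloisRepresentations.HeckeCharacter ℚ) (hχ : χ.IsFiniteOrder) : (π.twist χ hχ).IsOfWeightOne := by
  refine ⟨HasArchParameter.twist π χ hχ h.1, fun ψ hψ => ?_⟩
  obtain ⟨φ, hφ, rfl⟩ := Submodule.mem_map.1 hψ
  rw [twist_W', rightTranslation_mulChar, detTwist_ofArch_neg_one hχ, Units.val_one, one_smul, ← map_add]
  exact Submodule.mem_map_of_mem (h.2 φ hφ)

end WeightOne

end AutomorphicRepData

end Literature.NumberTheory.Automorphic

end
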